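import Literature.NumberTheory.LFunctions.BondarenkoHeap2026Section6Weights
import Literature.NumberTheory.LFunctions.BondarenkoHeap2026CompleteSumsProofs
import Literature.NumberTheory.LFunctions.BondarenkoHeap2026PrimeSumsProofs
import Literature.NumberTheory.LFunctions.BondarenkoHeap2026Prop3Proofs
import HarnessLib

/-!
# Bondarenko–Heap 2026, §6: the primed (loss-per-derivative) range bounds PROVED from the
# exported cores — Ranges I′, II′ outright, III′ modulo Proposition 2

Topic `Literature/NumberTheory/LFunctions`, namespace
`Literature.NumberTheory.LFunctions.BondarenkoHeap2026`. Everything in this file is PROVED (theorems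
only). LABEL (cell `rh-crit`, corpus C5 `ah`): **NOT RH-BEARING** — finite character-sum bookkeeping
inside §6 of an unrefereed preprint; nothing here bears on the truth of RH.

The correction block E-ah-3/G-ah-9 (`BondarenkoHeap2026Section6Weights.lean`) re-typed the §6.2
weight/scale interface with a loss `q^{ε₁}` PER DERIVATIVE (`IsSmoothDyadicWeight'`,
`‖a^{(j)}‖ ≤ A_j Q^j/X^j`) and pieces down to scale `1/2` (`IsAdmissibleScale'`), and vendored the
three range bounds over that interface as named facts `rangeI'_bound`, `rangeII'_bound`,
`rangeIII'_bound`. This file DISCHARGES the first two, and proves the third modulo `prop2`,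
from the exported cores of `BondarenkoHeap2026Section6Proofs.lean` (v8/v9/v10), which isolate
exactly what the printed arguments consume of the weights:

* Range I ([BondarenkoHeap2026, §6.3, (23), TeX l.864–878]: Lemma 4 on the `m`-sum, (16) on the
  `r`-sum, the `k`-sum trivially) uses `b` only through `‖b‖_BV ≪ q^ε`, i.e. `‖b‖ ≤ 1` and
  `‖b′‖ ≤ A₁ q^{ε₁}/M` (the `j = 1` clause of the primed class,
  `norm_deriv_le_of_isSmoothDyadicWeight'`), and `a, c` only through `‖·‖ ≤ 1` — the data of
  `rangeI_bound_core_of_lemma4`; Lemma 4 is a theorem (`lemma4_holds`, `…CompleteSumsProofs`).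
* Range II ([BondarenkoHeap2026, §6.4, (27), TeX l.986–996]: Lemmas 7 and 8) uses no derivative
  of any weight, only windows and `1`-boundedness — the data of
  `rangeII_bound_core_of_lemma7_lemma8`; Lemmas 7, 8 are theorems (`lemma7_holds`, `lemma8_holds`).
* Range III ([BondarenkoHeap2026, §6.5, (40), TeX l.998–1024, l.1295–1306]: (28), Lemma 9 (32),
  Lemma 10) uses `b, c` only through windows and `1`-boundedness, and `a` through `‖a‖ ≤ 1` and
  Lemma 10 applied to `V(x) = a(Kx)` — whose hypotheses over the primed class are exactly those
  of `lemma10'` (`‖V^{(j)}‖ ≤ A_j q^{jε₁}`, `lemma10Weight_of_isSmoothDyadicWeight'`) — the data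
  of `rangeIII_bound_core_of_lemma9` (v10); Lemma 9 is a theorem (`lemma9_bound_holds`), Lemma 10′
  is a theorem modulo `prop2` (`lemma10'_of_prop2`, sibling `…PrimeSumsProofs`).

The cores are stated for scales `K, M, R ≥ 1` (`IsAdmissibleScale`); the primed admissibility
allows `[1/2, 1)`. Those slices are handled here, once, at the implied constant `2C₀`
([BondarenkoHeap2026, §6.2, TeX l.840]: "pieces with `K`, `M` or `R < 1` are finitely many single
terms"):

* `corrSumE_eq_zero_of_lt_one` — `1/2 ≤ K < 1`: the `k`-box is `{1}`, `Λ(1) = 0`, `E = 0`;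
* `corrSumE_cut_eq` — `1/2 ≤ R < 1`: the `r`-box is `{1}` and `E(K,M,R; c) = E(K,M,1; 1_{x=1}c)`,
  the cut weight being `1`-bounded and supported in `[1,2]` (all the cores ask of `c`), and
  `(K, M, 1)` is admissible at `2C₀` since `1 ≤ 2R`;
* `rpow_le_of_M_lt_one`, `norm_corrSumE_le_small` — `1/2 ≤ M < 1` in Ranges I–II (where `b`
  must stay smooth, so cannot be cut): then `1/2 ≤ R ≤ C₀KM/T < C₀K/T ≤ C₀q^{−δ/10}` forces
  `q^{δ/10} ≤ 2C₀`, i.e. `q ≤ Q₁ := (2C₀+2)^{20/δ}`, where the trivial bound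
  (`norm_corrSumE_le_trivial`) is `≤ E₁(C₀,Q₁)` while the target is `≥ C · (2C₀)⁻¹ · Q₁^{−θ}`;
* `corrSumE_cutM_eq`, `exists_cut_weight_M`, `exists_cut_weight_R` — in Range III (no
  smoothness of `b, c` needed) both slices are cut to scale `1`, costing a factor `2` (`KM' ≤ 2KM`).

Main results: `rangeI'_bound_of_lemma4 : lemma4 → rangeI'_bound`, `rangeI'_bound_holds`;
`rangeII'_bound_of_lemma7_lemma8 : lemma7 → lemma8 → rangeII'_bound`, `rangeII'_bound_holds`;
`rangeIII'_bound_of_lemma9_lemma10' : lemma9_bound → lemma10' → rangeIII'_bound`,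
`rangeIII'_bound_of_lemma10'`, `rangeIII'_bound_of_prop2 : prop2 → rangeIII'_bound`; assembly
`prop6_of_reduction'_of_prop2 : offDiag_reduction' → prop2 → prop6` and
`theorem4_of_reduction'_of_prop2` — i.e. Proposition 6 / Theorem 4 are theorems modulo exactly
{`offDiag_reduction'`, `prop2`} (cell census v19).

## References

* [BondarenkoHeap2026] arXiv:2608.07399v1, §6.2 (TeX l.766, l.834–840, l.853–857); §6.3, eq. (23)
  (l.864–878); §6.4, eq. (27) (l.986–996); §6.5, eq. (40) (l.998–1024, l.1295–1309); Lemma 10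
  (l.1108–1123); Prop. 6 (l.745–770); Thm. 4 (§2).
-/

noncomputable section

open scoped ContDiff ArithmeticFunction.vonMangoldt
open Finset

namespace Literature.NumberTheory.LFunctions.BondarenkoHeap2026

/-- **Scales `K < 1` are vacuous**: for `1/2 ≤ K < 1` the box `1 ≤ k ≤ ⌊2K⌋` is `{1}` and
`Λ(1) = 0`, so `E(K,M,R) = 0`. [cite: BondarenkoHeap2026, §6.2, TeX l.840] -/
theorem corrSumE_eq_zero_of_lt_one {q : ℕ} (χ : DirichletCharacter ℂ q) (s : ℤ) {K M R : ℝ}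
    (hK : 2⁻¹ ≤ K) (hK1 : K < 1) (a b c : ℝ → ℂ) : corrSumE χ s K M R a b c = 0 := by
  have hfloor : ⌊2 * K⌋₊ = 1 := by
    rw [Nat.floor_eq_iff (by linarith)]
    constructor <;> push_cast <;> linarith
  rw [corrSumE, hfloor, Finset.Icc_self, Finset.sum_singleton]
  simp [ArithmeticFunction.vonMangoldt_apply_one]

/-- The `j = 1` clause of the primed class: `‖b′(x)‖ ≤ A 1 · Q / M`.
[cite: BondarenkoHeap2026, §6.2, TeX l.834–836] -/
theorem norm_deriv_le_of_isSmoothDyadicWeight' {M : ℝ} {A : ℕ → ℝ} {Q : ℝ} {b : ℝ → ℂ}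
    (hb : IsSmoothDyadicWeight' M A Q b) (x : ℝ) : ‖deriv b x‖ ≤ A 1 * Q / M := by
  have h := hb.2.2.2 1 x
  rwa [iteratedDeriv_one, pow_one, pow_one] at h

/-! ### The slice `r = 1` (scales `R ∈ [1/2, 1)`): the same sum at scale `1`, `c` cut to `r = 1` -/

/-- For `R ∈ [1/2, 1)` the `r`-box is `{1}`, and `E(K,M,R)` with weight `c` equals `E(K,M,1)` with
the weight `x ↦ 1_{x=1} c(x)` (whose `r`-box `{1,2}` contributes only `r = 1`); the cut weight is
`1`-bounded and supported in `[1, 2]`, which is all the Range I/II cores ask of `c`.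
[cite: BondarenkoHeap2026, §6.2, TeX l.840] -/
theorem corrSumE_cut_eq {q : ℕ} (χ : DirichletCharacter ℂ q) (s : ℤ) {K M R : ℝ}
    (hR : 2⁻¹ ≤ R) (hR1 : R < 1) (a b c : ℝ → ℂ) :
    corrSumE χ s K M 1 a b (fun x : ℝ => if x = 1 then c x else 0) = corrSumE χ s K M R a b c := by
  have hfloorR : ⌊2 * R⌋₊ = 1 := by
    rw [Nat.floor_eq_iff (by linarith)]
    constructor <;> push_cast <;> linarith
  have hfloor1 : ⌊(2 : ℝ) * 1⌋₊ = 2 := by norm_num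
  have h12 : Finset.Icc 1 2 = ({1, 2} : Finset ℕ) := by decide
  unfold corrSumE
  rw [hfloorR, hfloor1, h12, Finset.Icc_self]
  refine Finset.sum_congr rfl fun k _ => ?_
  congr 1
  refine Finset.sum_congr rfl fun m _ => ?_
  rw [Finset.sum_pair (by norm_num), Finset.sum_singleton]
  simp

/-! ### The slice `m = 1` (scales `M ∈ [1/2, 1)`) is empty for large `q` in Ranges I–II, and the
trivial bound absorbs the small `q` -/

/-- **`M < 1` forces `q` small in Ranges I–II**: if `1/2 ≤ R ≤ C₀KM/T` with `M < 1`, `K > 0` and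
`K ≤ T q^{−δ/10}` (`T = q^{7/3+δ}`), then `q^{δ/10} ≤ 2C₀`.
[cite: BondarenkoHeap2026, §6.2, TeX l.766 and l.853–857] -/
theorem rpow_le_of_M_lt_one {q : ℕ} {δ C₀ K M R : ℝ} (hC₀ : 0 < C₀) (hq : (0 : ℝ) < q)
    (hK0 : 0 < K) (hM1 : M < 1) (hR : 2⁻¹ ≤ R)
    (hRle : R ≤ C₀ * (K * M) / (q : ℝ) ^ (7 / 3 + δ))
    (hKle : K ≤ (q : ℝ) ^ (7 / 3 + δ) * (q : ℝ) ^ (-(δ / 10))) :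
    (q : ℝ) ^ (δ / 10) ≤ 2 * C₀ := by
  set T : ℝ := (q : ℝ) ^ (7 / 3 + δ) with hT
  have hT0 : 0 < T := Real.rpow_pos_of_pos hq _
  have hqd : 0 < (q : ℝ) ^ (δ / 10) := Real.rpow_pos_of_pos hq _
  have hKM : K * M ≤ K := by nlinarith
  -- `R ≤ C₀ K/T ≤ C₀ q^{-δ/10}`
  have h1 : R ≤ C₀ * K / T := by
    refine hRle.trans ?_
    rw [div_le_div_iff_of_pos_right hT0]
    exact mul_le_mul_of_nonneg_left hKM hC₀.le
  have h2 : C₀ * K / T ≤ C₀ * (q : ℝ) ^ (-(δ / 10)) := by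
    rw [div_le_iff₀ hT0]
    calc C₀ * K ≤ C₀ * (T * (q : ℝ) ^ (-(δ / 10))) := mul_le_mul_of_nonneg_left hKle hC₀.le
      _ = C₀ * (q : ℝ) ^ (-(δ / 10)) * T := by ring
  have h3 : 2⁻¹ ≤ C₀ * (q : ℝ) ^ (-(δ / 10)) := hR.trans (h1.trans h2)
  rw [Real.rpow_neg hq.le] at h3
  have h4 : 2⁻¹ * (q : ℝ) ^ (δ / 10) ≤ C₀ := by
    have := mul_le_mul_of_nonneg_right h3 hqd.le
    rwa [mul_assoc, inv_mul_cancel₀ hqd.ne', mul_one] at this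
  linarith

/-- **The trivial bound on the small-`q` slices**: if `1 ≤ q ≤ Q₁`, `1 ≤ K`, `1/2 ≤ M ≤ 1`,
`1/2 ≤ R ≤ C₀KM/T`, `KM ≤ C₀ q^{17/6}` and `0 ≤ θ`, then for `1`-bounded weights
`‖E(K,M,R)‖ ≤ (2C₀ Q₁^θ E₁) · KM · q^{−θ}` with `E₁ = 16 K_b² R_b + 1`, `K_b = 2C₀Q₁^{17/6} + 1`,
`R_b = C₀²Q₁^{17/6} + 1` (so the constant depends on `C₀, Q₁, θ` only).
[cite: BondarenkoHeap2026, §6.2, TeX l.840] -/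
theorem norm_corrSumE_le_small {q : ℕ} [NeZero q] (χ : DirichletCharacter ℂ q) (s : ℤ)
    {δ C₀ Q₁ θ K M R : ℝ} (hC₀ : 0 < C₀) (hQ₁ : 1 ≤ Q₁) (hqQ : (q : ℝ) ≤ Q₁) (hθ : 0 ≤ θ)
    (hδ : 0 < δ) (hK1 : 1 ≤ K) (hM : 2⁻¹ ≤ M) (hM1 : M ≤ 1) (hR : 2⁻¹ ≤ R)
    (hRle : R ≤ C₀ * (K * M) / (q : ℝ) ^ (7 / 3 + δ))
    (hKMle : K * M ≤ C₀ * (q : ℝ) ^ (17 / 6 : ℝ)) (a b c : ℝ → ℂ)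
    (ha : ∀ x : ℝ, ‖a x‖ ≤ 1) (hb : ∀ x : ℝ, ‖b x‖ ≤ 1) (hc : ∀ x : ℝ, ‖c x‖ ≤ 1) :
    ‖corrSumE χ s K M R a b c‖ ≤
      (2 * C₀ * Q₁ ^ θ * (16 * (2 * C₀ * Q₁ ^ (17 / 6 : ℝ) + 1) ^ 2 *
        (C₀ ^ 2 * Q₁ ^ (17 / 6 : ℝ) + 1) + 1)) * (K * M) * (q : ℝ) ^ (-θ) := by
  have hq1 : (1 : ℝ) ≤ q := by exact_mod_cast NeZero.one_le
  have hq0 : (0 : ℝ) < q := by linarith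
  have hQ0 : 0 < Q₁ := by linarith
  set T : ℝ := (q : ℝ) ^ (7 / 3 + δ) with hT
  have hT1 : 1 ≤ T := Real.one_le_rpow hq1 (by linarith)
  have hT0 : 0 < T := by linarith
  set Kb : ℝ := 2 * C₀ * Q₁ ^ (17 / 6 : ℝ) + 1 with hKb
  set Rb : ℝ := C₀ ^ 2 * Q₁ ^ (17 / 6 : ℝ) + 1 with hRb
  have hQpow : (q : ℝ) ^ (17 / 6 : ℝ) ≤ Q₁ ^ (17 / 6 : ℝ) :=
    Real.rpow_le_rpow hq0.le hqQ (by norm_num)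
  have hQpow0 : 0 ≤ Q₁ ^ (17 / 6 : ℝ) := by positivity
  have hK0 : 0 < K := by linarith
  have hM0 : 0 < M := by linarith
  have hKM0 : 0 < K * M := mul_pos hK0 hM0
  -- `K ≤ Kb`, `R ≤ Rb`
  have hKle : K ≤ Kb := by
    have h1 : K ≤ 2 * (K * M) := by nlinarith
    have h2 : 2 * (K * M) ≤ 2 * C₀ * Q₁ ^ (17 / 6 : ℝ) := by nlinarith
    rw [hKb]; linarith
  have hRle' : R ≤ Rb := by
    have h1 : R ≤ C₀ * (K * M) := by
      refine hRle.trans ?_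
      rw [div_le_iff₀ hT0]
      nlinarith [mul_pos hC₀ hKM0]
    have h2 : C₀ * (K * M) ≤ C₀ * (C₀ * Q₁ ^ (17 / 6 : ℝ)) :=
      mul_le_mul_of_nonneg_left (hKMle.trans (mul_le_mul_of_nonneg_left hQpow hC₀.le)) hC₀.le
    rw [hRb]; nlinarith
  have hKb1 : 1 ≤ Kb := by rw [hKb]; nlinarith [mul_nonneg hC₀.le hQpow0]
  have hRb0 : 0 ≤ Rb := by rw [hRb]; positivity
  have hR0 : 0 ≤ R := by linarith
  -- trivial bound
  have htriv := norm_corrSumE_le_trivial χ s hK1 hM0.le hR0 a b c ha hb hc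
  have hlog : Real.log (2 * K) ≤ 2 * K :=
    (Real.log_le_sub_one_of_pos (by linarith)).trans (by linarith)
  have hE : ‖corrSumE χ s K M R a b c‖ ≤ 16 * Kb ^ 2 * Rb := by
    refine htriv.trans ?_
    have h1 : 2 * K * Real.log (2 * K) ≤ 2 * K * (2 * K) :=
      mul_le_mul_of_nonneg_left hlog (by linarith)
    have h2 : 2 * K * (2 * K) ≤ 4 * Kb ^ 2 := by nlinarith
    have h3 : 2 * M ≤ 2 := by linarith
    have h4 : 2 * R ≤ 2 * Rb := by linarith
    have hlog0 : 0 ≤ Real.log (2 * K) := Real.log_nonneg (by linarith)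
    calc 2 * K * Real.log (2 * K) * (2 * M) * (2 * R)
        ≤ (4 * Kb ^ 2) * 2 * (2 * Rb) := by
          apply mul_le_mul (mul_le_mul (h1.trans h2) h3 (by linarith) (by positivity)) h4
            (by linarith) (by positivity)
      _ = 16 * Kb ^ 2 * Rb := by ring
  set E₁ : ℝ := 16 * Kb ^ 2 * Rb + 1 with hE₁
  have hE₁ : ‖corrSumE χ s K M R a b c‖ ≤ E₁ := hE.trans (by rw [hE₁]; linarith)
  have hE₁0 : 0 ≤ E₁ := (norm_nonneg _).trans hE₁
  -- lower bound for the right-hand side: `KM ≥ T R/C₀ ≥ 1/(2C₀)`, `q^{-θ} ≥ Q₁^{-θ}`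
  have hKMge : 1 / (2 * C₀) ≤ K * M := by
    have h1 : R * T ≤ C₀ * (K * M) := by rwa [le_div_iff₀ hT0] at hRle
    have h2 : 2⁻¹ * 1 ≤ R * T := mul_le_mul hR hT1 zero_le_one hR0
    rw [div_le_iff₀ (by positivity)]
    nlinarith
  have hqθ : Q₁ ^ (-θ) ≤ (q : ℝ) ^ (-θ) := Real.rpow_le_rpow_of_nonpos hq0 hqQ (by linarith)
  have hQθ0 : 0 < Q₁ ^ (-θ) := Real.rpow_pos_of_pos hQ0 _
  have hQQ : Q₁ ^ θ * Q₁ ^ (-θ) = 1 := by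
    rw [← Real.rpow_add hQ0, add_neg_cancel, Real.rpow_zero]
  calc ‖corrSumE χ s K M R a b c‖ ≤ E₁ := hE₁
    _ = (2 * C₀ * Q₁ ^ θ * E₁) * (1 / (2 * C₀)) * Q₁ ^ (-θ) := by
        field_simp
        rw [mul_assoc, mul_comm (Q₁ ^ θ), ← mul_assoc]
        rw [mul_assoc E₁, mul_comm (Q₁ ^ (-θ)), hQQ]; ring
    _ ≤ (2 * C₀ * Q₁ ^ θ * E₁) * (K * M) * (q : ℝ) ^ (-θ) := by
        apply mul_le_mul (mul_le_mul_of_nonneg_left hKMge (by positivity)) hqθ hQθ0.le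
          (by positivity)

/-! ### Range I′ -/

/-- **(23), Range I over the primed interface, from Lemma 4**: `rangeI'_bound` follows from the
exported core `rangeI_bound_core_of_lemma4` (which consumes only `‖a‖ ≤ 1`, `‖c‖ ≤ 1`, and of `b`:
smooth, window `[M,2M]`, `‖b‖ ≤ 1`, `‖b′‖ ≤ A₁ q^{ε₁}/M` = the `j = 1` clause of the primed class),
applied at the implied constant `2C₀`: scales `K < 1` are empty (`Λ(1) = 0`), `R ∈ [1/2,1)` is the
slice `r = 1` (`corrSumE_cut_eq`), and `M ∈ [1/2,1)` forces `q^{δ/10} ≤ 2C₀`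
(`rpow_le_of_M_lt_one`), where the trivial bound suffices (`norm_corrSumE_le_small`).
[cite: BondarenkoHeap2026, eq. (23), TeX l.864–878] -/
theorem rangeI'_bound_of_lemma4 (h4 : lemma4) : rangeI'_bound := by
  intro δ hδ hδ1 C₀ hC₀ A
  have h2C₀ : 0 < 2 * C₀ := by positivity
  obtain ⟨ε₁, hε₁, C, hC, H⟩ := rangeI_bound_core_of_lemma4 h4 δ hδ hδ1 (2 * C₀) h2C₀ (A 1)
  -- the small-`q` constant
  set Q₁ : ℝ := (2 * C₀ + 2) ^ (20 / δ) with hQ₁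
  have hbase : (1 : ℝ) ≤ 2 * C₀ + 2 := by linarith
  have hQ₁1 : 1 ≤ Q₁ := Real.one_le_rpow hbase (by positivity)
  set θ : ℝ := δ / 10 / 2 with hθ
  have hθ0 : 0 ≤ θ := by positivity
  set Csmall : ℝ := 2 * C₀ * Q₁ ^ θ * (16 * (2 * C₀ * Q₁ ^ (17 / 6 : ℝ) + 1) ^ 2 *
    (C₀ ^ 2 * Q₁ ^ (17 / 6 : ℝ) + 1) + 1) with hCsmall
  have hCsmall0 : 0 < Csmall := by positivity
  refine ⟨ε₁, hε₁, C + Csmall, by positivity, ?_⟩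
  intro q _ χ hχp hχq K M R hadm hI s hs a b c ha hb hc
  obtain ⟨hK, hM, hR, hRle, hKMle⟩ := hadm
  have hq1 : (1 : ℝ) ≤ q := by exact_mod_cast NeZero.one_le
  have hq0 : (0 : ℝ) < q := by linarith
  have hK0 : 0 < K := by linarith
  have hM0 : 0 < M := by linarith
  have hKM0 : 0 < K * M := mul_pos hK0 hM0
  have hT0 : 0 < (q : ℝ) ^ (7 / 3 + δ) := Real.rpow_pos_of_pos hq0 _
  have hrhs0 : 0 ≤ (C + Csmall) * (K * M) * (q : ℝ) ^ (-θ) := by positivity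
  have hmonoC : ∀ {E : ℝ}, E ≤ C * (K * M) * (q : ℝ) ^ (-θ) →
      E ≤ (C + Csmall) * (K * M) * (q : ℝ) ^ (-θ) := fun h =>
    h.trans (by gcongr; linarith)
  have hmonoCs : ∀ {E : ℝ}, E ≤ Csmall * (K * M) * (q : ℝ) ^ (-θ) →
      E ≤ (C + Csmall) * (K * M) * (q : ℝ) ^ (-θ) := fun h =>
    h.trans (by gcongr; linarith)
  -- the weights' elementary data
  have ha1 : ∀ x, ‖a x‖ ≤ 1 := ha.2.2.1
  have hb1 : ∀ x, ‖b x‖ ≤ 1 := hb.2.2.1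
  have hc1 : ∀ x, ‖c x‖ ≤ 1 := hc.2.2.1
  have hbd : ∀ x, ‖deriv b x‖ ≤ A 1 * (q : ℝ) ^ ε₁ / M := norm_deriv_le_of_isSmoothDyadicWeight' hb
  by_cases hK1 : 1 ≤ K
  swap
  · -- `K < 1`: the sum is empty
    rw [corrSumE_eq_zero_of_lt_one χ s hK (lt_of_not_ge hK1), norm_zero]
    exact hrhs0
  by_cases hM1 : 1 ≤ M
  swap
  · -- `M < 1`: `q` is small, trivial bound
    have hM1' : M < 1 := lt_of_not_ge hM1
    have hKle : K ≤ (q : ℝ) ^ (7 / 3 + δ) * (q : ℝ) ^ (-(δ / 10)) := by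
      refine le_trans hI (mul_le_mul_of_nonneg_left ?_ hT0.le)
      exact Real.rpow_le_rpow_of_exponent_le hq1 (by linarith)
    have hqs := rpow_le_of_M_lt_one hC₀ hq0 hK0 hM1' hR hRle hKle
    have hqQ : (q : ℝ) ≤ Q₁ := by
      by_contra hlt
      push Not at hlt
      have h1 : Q₁ ^ (δ / 10) ≤ (q : ℝ) ^ (δ / 10) :=
        Real.rpow_le_rpow (by linarith) hlt.le (by positivity)
      have h2 : Q₁ ^ (δ / 10) = (2 * C₀ + 2) ^ (2 : ℝ) := by
        rw [hQ₁, ← Real.rpow_mul (by linarith)]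
        congr 1; field_simp; ring
      have h3 : (2 * C₀ + 2) ^ (2 : ℝ) = (2 * C₀ + 2) ^ 2 := by norm_cast
      rw [h2, h3] at h1
      nlinarith
    exact hmonoCs (norm_corrSumE_le_small χ s hC₀ hQ₁1 hqQ hθ0 hδ hK1 hM hM1'.le hR hRle hKMle
      a b c ha1 hb1 hc1)
  -- admissibility at the implied constant `2C₀`
  have hRle2 : ∀ {R' : ℝ}, R' ≤ 2 * R → R' ≤ 2 * C₀ * (K * M) / (q : ℝ) ^ (7 / 3 + δ) := by
    intro R' h
    refine h.trans ?_
    rw [show 2 * C₀ * (K * M) / (q : ℝ) ^ (7 / 3 + δ) = 2 * (C₀ * (K * M) / (q : ℝ) ^ (7 / 3 + δ))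
      by ring]
    linarith
  have hKMle2 : K * M ≤ 2 * C₀ * (q : ℝ) ^ (17 / 6 : ℝ) := by
    have : 0 ≤ C₀ * (q : ℝ) ^ (17 / 6 : ℝ) := by positivity
    linarith
  by_cases hR1 : 1 ≤ R
  · -- generic scales: the core at `2C₀`
    have hadm2 : IsAdmissibleScale q δ (2 * C₀) K M R :=
      ⟨hK1, hM1, hR1, hRle2 (by linarith), hKMle2⟩
    exact hmonoC (H q χ hχp hχq K M R hadm2 hI s hs a b c ha1 hb.1 hb.2.1 hb1 hbd hc1)
  · -- `R ∈ [1/2, 1)`: the slice `r = 1` at scale `1`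
    have hR1' : R < 1 := lt_of_not_ge hR1
    have hadm2 : IsAdmissibleScale q δ (2 * C₀) K M 1 :=
      ⟨hK1, hM1, le_rfl, hRle2 (by linarith), hKMle2⟩
    have hc1' : ∀ x : ℝ, ‖(fun x : ℝ => if x = 1 then c x else 0) x‖ ≤ 1 := by
      intro x; by_cases hx : x = 1 <;> simp [hx, hc1]
    have h := H q χ hχp hχq K M 1 hadm2 hI s hs a b _ ha1 hb.1 hb.2.1 hb1 hbd hc1'
    rw [corrSumE_cut_eq χ s hR hR1' a b c] at h
    exact hmonoC h

/-- **(23), Range I′ — DISCHARGED**: `rangeI'_bound` holds outright (`lemma4_holds`,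
`…CompleteSumsProofs`). [cite: BondarenkoHeap2026, eq. (23), TeX l.864–878] -/
theorem rangeI'_bound_holds : rangeI'_bound :=
  rangeI'_bound_of_lemma4 lemma4_holds

/-! ### Range II′ -/

/-- **(27), Range II over the primed interface, from Lemmas 7 and 8**: `rangeII'_bound` follows
from the exported core `rangeII_bound_core_of_lemma7_lemma8` (which consumes only the windows and
`1`-boundedness of `a, b, c` — "§6.4 uses no derivative of any weight"), at the implied constant
`2C₀`, with the same treatment of the scales below `1` as in Range I′.
[cite: BondarenkoHeap2026, eq. (27), TeX l.986–996] -/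
theorem rangeII'_bound_of_lemma7_lemma8 (h7 : lemma7) (h8 : lemma8) : rangeII'_bound := by
  intro δ hδ hδ1 C₀ hC₀ A
  have h2C₀ : 0 < 2 * C₀ := by positivity
  obtain ⟨C, hC, H⟩ := rangeII_bound_core_of_lemma7_lemma8 h7 h8 δ hδ hδ1 (2 * C₀) h2C₀
  set Q₁ : ℝ := (2 * C₀ + 2) ^ (20 / δ) with hQ₁
  have hbase : (1 : ℝ) ≤ 2 * C₀ + 2 := by linarith
  have hQ₁1 : 1 ≤ Q₁ := Real.one_le_rpow hbase (by positivity)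
  set θ : ℝ := δ / 10 / 4 with hθ
  have hθ0 : 0 ≤ θ := by positivity
  set Csmall : ℝ := 2 * C₀ * Q₁ ^ θ * (16 * (2 * C₀ * Q₁ ^ (17 / 6 : ℝ) + 1) ^ 2 *
    (C₀ ^ 2 * Q₁ ^ (17 / 6 : ℝ) + 1) + 1) with hCsmall
  have hCsmall0 : 0 < Csmall := by positivity
  refine ⟨1, one_pos, C + Csmall, by positivity, ?_⟩
  intro q _ χ hχp hχq K M R hadm hII s hs a b c ha hb hc
  obtain ⟨hK, hM, hR, hRle, hKMle⟩ := hadm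
  have hq1 : (1 : ℝ) ≤ q := by exact_mod_cast NeZero.one_le
  have hq0 : (0 : ℝ) < q := by linarith
  have hK0 : 0 < K := by linarith
  have hM0 : 0 < M := by linarith
  have hKM0 : 0 < K * M := mul_pos hK0 hM0
  have hT0 : 0 < (q : ℝ) ^ (7 / 3 + δ) := Real.rpow_pos_of_pos hq0 _
  have hrhs0 : 0 ≤ (C + Csmall) * (K * M) * (q : ℝ) ^ (-θ) := by positivity
  have hmonoC : ∀ {E : ℝ}, E ≤ C * (K * M) * (q : ℝ) ^ (-θ) →
      E ≤ (C + Csmall) * (K * M) * (q : ℝ) ^ (-θ) := fun h =>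
    h.trans (by gcongr; linarith)
  have hmonoCs : ∀ {E : ℝ}, E ≤ Csmall * (K * M) * (q : ℝ) ^ (-θ) →
      E ≤ (C + Csmall) * (K * M) * (q : ℝ) ^ (-θ) := fun h =>
    h.trans (by gcongr; linarith)
  have ha1 : ∀ x, ‖a x‖ ≤ 1 := ha.2.2.1
  have hb1 : ∀ x, ‖b x‖ ≤ 1 := hb.2.2.1
  have hc1 : ∀ x, ‖c x‖ ≤ 1 := hc.2.2.1
  by_cases hK1 : 1 ≤ K
  swap
  · rw [corrSumE_eq_zero_of_lt_one χ s hK (lt_of_not_ge hK1), norm_zero]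
    exact hrhs0
  by_cases hM1 : 1 ≤ M
  swap
  · have hM1' : M < 1 := lt_of_not_ge hM1
    have hKle : K ≤ (q : ℝ) ^ (7 / 3 + δ) * (q : ℝ) ^ (-(δ / 10)) := hII.2
    have hqs := rpow_le_of_M_lt_one hC₀ hq0 hK0 hM1' hR hRle hKle
    have hqQ : (q : ℝ) ≤ Q₁ := by
      by_contra hlt
      push Not at hlt
      have h1 : Q₁ ^ (δ / 10) ≤ (q : ℝ) ^ (δ / 10) :=
        Real.rpow_le_rpow (by linarith) hlt.le (by positivity)
      have h2 : Q₁ ^ (δ / 10) = (2 * C₀ + 2) ^ (2 : ℝ) := by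
        rw [hQ₁, ← Real.rpow_mul (by linarith)]
        congr 1; field_simp; ring
      have h3 : (2 * C₀ + 2) ^ (2 : ℝ) = (2 * C₀ + 2) ^ 2 := by norm_cast
      rw [h2, h3] at h1
      nlinarith
    exact hmonoCs (norm_corrSumE_le_small χ s hC₀ hQ₁1 hqQ hθ0 hδ hK1 hM hM1'.le hR hRle hKMle
      a b c ha1 hb1 hc1)
  have hRle2 : ∀ {R' : ℝ}, R' ≤ 2 * R → R' ≤ 2 * C₀ * (K * M) / (q : ℝ) ^ (7 / 3 + δ) := by
    intro R' h
    refine h.trans ?_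
    rw [show 2 * C₀ * (K * M) / (q : ℝ) ^ (7 / 3 + δ) = 2 * (C₀ * (K * M) / (q : ℝ) ^ (7 / 3 + δ))
      by ring]
    linarith
  have hKMle2 : K * M ≤ 2 * C₀ * (q : ℝ) ^ (17 / 6 : ℝ) := by
    have : 0 ≤ C₀ * (q : ℝ) ^ (17 / 6 : ℝ) := by positivity
    linarith
  by_cases hR1 : 1 ≤ R
  · have hadm2 : IsAdmissibleScale q δ (2 * C₀) K M R :=
      ⟨hK1, hM1, hR1, hRle2 (by linarith), hKMle2⟩
    exact hmonoC (H q χ hχp hχq K M R hadm2 hII s hs a b c ha.2.1 ha1 hb.2.1 hb1 hc.2.1 hc1)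
  · have hR1' : R < 1 := lt_of_not_ge hR1
    have hadm2 : IsAdmissibleScale q δ (2 * C₀) K M 1 :=
      ⟨hK1, hM1, le_rfl, hRle2 (by linarith), hKMle2⟩
    have hc1' : ∀ x : ℝ, ‖(fun x : ℝ => if x = 1 then c x else 0) x‖ ≤ 1 := by
      intro x; by_cases hx : x = 1 <;> simp [hx, hc1]
    have hcsupp' : ∀ x : ℝ, (fun x : ℝ => if x = 1 then c x else 0) x ≠ 0 → 1 ≤ x ∧ x ≤ 2 * 1 := by
      intro x hx
      by_cases h1 : x = 1
      · subst h1; norm_num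
      · simp [h1] at hx
    have h := H q χ hχp hχq K M 1 hadm2 hII s hs a b _ ha.2.1 ha1 hb.2.1 hb1 hcsupp' hc1'
    rw [corrSumE_cut_eq χ s hR hR1' a b c] at h
    exact hmonoC h

/-- **(27), Range II′ — DISCHARGED** (`lemma7_holds`, `lemma8_holds`).
[cite: BondarenkoHeap2026, eq. (27), TeX l.986–996] -/
theorem rangeII'_bound_holds : rangeII'_bound :=
  rangeII'_bound_of_lemma7_lemma8 lemma7_holds lemma8_holds

/-! ### Range III′ -/

/-- The slice `m = 1` (scales `M ∈ [1/2, 1)`): the `m`-box is `{1}`, and `E(K,M,R)` with weight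
`b` equals `E(K,1,R)` with the weight `x ↦ 1_{x=1} b(x)` (whose `m`-box `{1,2}` contributes only
`m = 1`). [cite: BondarenkoHeap2026, §6.2, TeX l.840] -/
theorem corrSumE_cutM_eq {q : ℕ} (χ : DirichletCharacter ℂ q) (s : ℤ) {K M R : ℝ}
    (hM : 2⁻¹ ≤ M) (hM1 : M < 1) (a b c : ℝ → ℂ) :
    corrSumE χ s K 1 R a (fun x : ℝ => if x = 1 then b x else 0) c = corrSumE χ s K M R a b c := by
  have hfloorM : ⌊2 * M⌋₊ = 1 := by
    rw [Nat.floor_eq_iff (by linarith)]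
    constructor <;> push_cast <;> linarith
  have hfloor1 : ⌊(2 : ℝ) * 1⌋₊ = 2 := by norm_num
  have h12 : Finset.Icc 1 2 = ({1, 2} : Finset ℕ) := by decide
  unfold corrSumE
  rw [hfloorM, hfloor1, h12, Finset.Icc_self]
  refine Finset.sum_congr rfl fun k _ => ?_
  congr 1
  rw [Finset.sum_pair (by norm_num), Finset.sum_singleton]
  simp

/-- **Cutting the `b`-weight to scale `≥ 1`**: for `M ≥ 1/2` and a `1`-bounded `b` supported in
`[M,2M]` there are a scale `M' ∈ [max(M,1), 2M]` and a `1`-bounded `b'` supported in `[M',2M']`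
with the same correlation sum (for `M ≥ 1`: `b' = b`; for `M < 1`: the slice `m = 1`,
`corrSumE_cutM_eq`). [cite: BondarenkoHeap2026, §6.2, TeX l.840] -/
theorem exists_cut_weight_M {M : ℝ} (hM : 2⁻¹ ≤ M) {b : ℝ → ℂ} (hb1 : ∀ x : ℝ, ‖b x‖ ≤ 1)
    (hbsupp : ∀ x : ℝ, b x ≠ 0 → M ≤ x ∧ x ≤ 2 * M) :
    ∃ (M' : ℝ) (b' : ℝ → ℂ), 1 ≤ M' ∧ M ≤ M' ∧ M' ≤ 2 * M ∧ (∀ x : ℝ, ‖b' x‖ ≤ 1) ∧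
      (∀ x : ℝ, b' x ≠ 0 → M' ≤ x ∧ x ≤ 2 * M') ∧
      ∀ {q : ℕ} (χ : DirichletCharacter ℂ q) (s : ℤ) (K R : ℝ) (a c : ℝ → ℂ),
        corrSumE χ s K M' R a b' c = corrSumE χ s K M R a b c := by
  by_cases hM1 : 1 ≤ M
  · exact ⟨M, b, hM1, le_rfl, by linarith, hb1, hbsupp, fun _ _ _ _ _ _ => rfl⟩
  · have hM1' : M < 1 := lt_of_not_ge hM1
    refine ⟨1, fun x => if x = 1 then b x else 0, le_rfl, hM1'.le, by linarith, ?_, ?_, ?_⟩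
    · intro x
      by_cases hx : x = 1 <;> simp [hx, hb1]
    · intro x hx
      by_cases h1 : x = 1
      · subst h1; norm_num
      · simp [h1] at hx
    · intro q χ s K R a c
      exact corrSumE_cutM_eq χ s hM hM1' a b c

/-- **Cutting the `c`-weight to scale `≥ 1`**: for `R ≥ 1/2` and a `1`-bounded `c` supported in
`[R,2R]` there are a scale `R' ∈ [1, 2R]`… precisely `R' = R` (`R ≥ 1`) or `R' = 1` (`R < 1`, the
slice `r = 1`, `corrSumE_cut_eq`) and a `1`-bounded `c'` supported in `[R',2R']` with the same
correlation sum. [cite: BondarenkoHeap2026, §6.2, TeX l.840] -/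
theorem exists_cut_weight_R {R : ℝ} (hR : 2⁻¹ ≤ R) {c : ℝ → ℂ} (hc1 : ∀ x : ℝ, ‖c x‖ ≤ 1)
    (hcsupp : ∀ x : ℝ, c x ≠ 0 → R ≤ x ∧ x ≤ 2 * R) :
    ∃ (R' : ℝ) (c' : ℝ → ℂ), 1 ≤ R' ∧ R' ≤ 2 * R ∧ (∀ x : ℝ, ‖c' x‖ ≤ 1) ∧
      (∀ x : ℝ, c' x ≠ 0 → R' ≤ x ∧ x ≤ 2 * R') ∧
      ∀ {q : ℕ} (χ : DirichletCharacter ℂ q) (s : ℤ) (K M : ℝ) (a b : ℝ → ℂ),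
        corrSumE χ s K M R' a b c' = corrSumE χ s K M R a b c := by
  by_cases hR1 : 1 ≤ R
  · exact ⟨R, c, hR1, by linarith, hc1, hcsupp, fun _ _ _ _ _ _ => rfl⟩
  · have hR1' : R < 1 := lt_of_not_ge hR1
    refine ⟨1, fun x => if x = 1 then c x else 0, le_rfl, by linarith, ?_, ?_, ?_⟩
    · intro x
      by_cases hx : x = 1 <;> simp [hx, hc1]
    · intro x hx
      by_cases h1 : x = 1
      · subst h1; norm_num
      · simp [h1] at hx
    · intro q χ s K M a b
      exact corrSumE_cut_eq χ s hR hR1' a b c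

/-- The weight `a` of the PRIMED class at scale `K`, read as `V(x) = a(Kx)` on `[1,2]`: the
hypotheses of Lemma 10′ for `V` — smooth, supported in `[1,2]`, `‖V^{(j)}‖ ≤ A_j Q^j` (TeX l.836
"`a_k = V(k/K)` … `‖V^{(j)}‖_∞ ≪ q^ε`", with the honest loss `q^{jε₁}`, E-ah-3).
[cite: BondarenkoHeap2026, §6.2, TeX l.836] -/
theorem lemma10Weight_of_isSmoothDyadicWeight' {K : ℝ} (hK : 0 < K) {A : ℕ → ℝ} {Q : ℝ}
    {a : ℝ → ℂ} (ha : IsSmoothDyadicWeight' K A Q a) :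
    ContDiff ℝ ∞ (fun x : ℝ => a (K * x)) ∧
      (∀ x : ℝ, a (K * x) ≠ 0 → 1 ≤ x ∧ x ≤ 2) ∧
      (∀ (j : ℕ) (x : ℝ), ‖iteratedDeriv j (fun x : ℝ => a (K * x)) x‖ ≤ A j * Q ^ j) := by
  obtain ⟨hsmooth, hsupp, -, hder⟩ := ha
  refine ⟨hsmooth.comp (contDiff_const.mul contDiff_id), fun x hx => ?_, fun j x => ?_⟩
  · obtain ⟨h1, h2⟩ := hsupp (K * x) hx
    constructor
    · exact le_of_mul_le_mul_left (by linarith : K * 1 ≤ K * x) hK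
    · exact le_of_mul_le_mul_left (by linarith : K * x ≤ K * 2) hK
  · have hcd : ContDiff ℝ j a := hsmooth.of_le (by exact_mod_cast le_top)
    rw [iteratedDeriv_comp_const_smul hcd K]
    simp only [norm_smul, norm_pow, Real.norm_eq_abs, abs_of_pos hK]
    have hKj : 0 < K ^ j := pow_pos hK j
    calc K ^ j * ‖iteratedDeriv j a (K * x)‖ ≤ K ^ j * (A j * Q ^ j / K ^ j) :=
          mul_le_mul_of_nonneg_left (hder j (K * x)) hKj.le
      _ = A j * Q ^ j := by field_simp

/-- **(40), Range III over the primed interface, from Lemma 9 (32) and Lemma 10′**: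
`rangeIII'_bound` follows from the exported core `rangeIII_bound_core_of_lemma9`
(`BondarenkoHeap2026Section6Proofs`, v10), which consumes of the weights only `‖a‖,‖b‖,‖c‖ ≤ 1`,
the windows of `b, c`, and the OUTPUT of Lemma 10 for `V(x) = a(Kx)` — supplied here by `lemma10'`
through `lemma10Weight_of_isSmoothDyadicWeight'` — at the implied constant `2C₀`: in Range III
`K ≥ q^{7/3+2δ/10} ≥ 1` automatically, and the slices `M ∈ [1/2,1)`, `R ∈ [1/2,1)` are the same
sums at scale `1` with cut weights (`exists_cut_weight_M`, `exists_cut_weight_R`), admissible at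
`2C₀`, costing a factor `2` in the constant (`KM' ≤ 2KM`).
[cite: BondarenkoHeap2026, eq. (40), TeX l.1295–1306] -/
theorem rangeIII'_bound_of_lemma9_lemma10' (h9 : lemma9_bound) (h10 : lemma10') :
    rangeIII'_bound := by
  intro δ hδ hδ1 C₀ hC₀ A
  have hη0 : 0 < δ / 10 := by positivity
  have hε0 : 0 < δ / 8 := by positivity
  obtain ⟨ε₁, hε₁, H10A⟩ := h10 (δ / 10) hη0 (δ / 8) hε0
  obtain ⟨C₁₀, hC₁₀, H10⟩ := H10A A
  have h2C₀ : 0 < 2 * C₀ := by positivity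
  obtain ⟨C, hC, H⟩ := rangeIII_bound_core_of_lemma9 h9 δ hδ hδ1 (2 * C₀) h2C₀ C₁₀ hC₁₀
  refine ⟨ε₁, hε₁, 2 * C, by positivity, ?_⟩
  intro q _ χ hχp hχq K M R hadm hIII s hs a b c ha hb hc
  obtain ⟨-, hM, hR, hRle, hKMle⟩ := hadm
  have hq1 : (1 : ℝ) ≤ q := by exact_mod_cast NeZero.one_le
  have hq0 : (0 : ℝ) < q := by linarith
  have hK1 : 1 ≤ K := le_trans (Real.one_le_rpow hq1 (by positivity)) hIII
  have hK0 : 0 < K := by linarith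
  have hT0 : 0 < (q : ℝ) ^ (7 / 3 + δ) := Real.rpow_pos_of_pos hq0 _
  obtain ⟨M', b', hM'1, hMM', hM'le, hb'1, hb'supp, hbE⟩ :=
    exists_cut_weight_M hM hb.2.2.1 hb.2.1
  obtain ⟨R', c', hR'1, hR'le, hc'1, hc'supp, hcE⟩ := exists_cut_weight_R hR hc.2.2.1 hc.2.1
  -- `(K, M', R')` is admissible at the implied constant `2C₀`
  have hadm2 : IsAdmissibleScale q δ (2 * C₀) K M' R' := by
    refine ⟨hK1, hM'1, hR'1, ?_, ?_⟩
    · have h1 : C₀ * (K * M) / (q : ℝ) ^ (7 / 3 + δ) ≤ C₀ * (K * M') / (q : ℝ) ^ (7 / 3 + δ) :=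
        div_le_div_of_nonneg_right
          (mul_le_mul_of_nonneg_left (mul_le_mul_of_nonneg_left hMM' hK0.le) hC₀.le) hT0.le
      calc R' ≤ 2 * R := hR'le
        _ ≤ 2 * (C₀ * (K * M') / (q : ℝ) ^ (7 / 3 + δ)) := by linarith [hRle.trans h1]
        _ = 2 * C₀ * (K * M') / (q : ℝ) ^ (7 / 3 + δ) := by ring
    · have h1 : K * M' ≤ K * (2 * M) := mul_le_mul_of_nonneg_left hM'le hK0.le
      linarith
  obtain ⟨hVs, hVsupp, hVder⟩ := lemma10Weight_of_isSmoothDyadicWeight' hK0 ha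
  have hmain := H q χ hχp hχq K M' R' hadm2 hIII s hs a b' c' ha.2.2.1
    (H10 q χ hχp hχq K hIII (fun x => a (K * x)) hVs hVsupp hVder) hb'supp hb'1 hc'supp hc'1
  rw [hcE, hbE] at hmain
  refine hmain.trans ?_
  have hθ0 : 0 ≤ (q : ℝ) ^ (-(δ / 2)) := by positivity
  have h2 : C * (K * M') ≤ 2 * C * (K * M) := by
    have := mul_le_mul_of_nonneg_left hM'le (mul_nonneg hC.le hK0.le)
    linarith
  exact mul_le_mul_of_nonneg_right h2 hθ0

/-- **(40), Range III′ modulo Lemma 10′** (Lemma 9 (32) is a theorem: `lemma9_bound_holds`).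
[cite: BondarenkoHeap2026, eq. (40), TeX l.1295–1306] -/
theorem rangeIII'_bound_of_lemma10' (h10 : lemma10') : rangeIII'_bound :=
  rangeIII'_bound_of_lemma9_lemma10' lemma9_bound_holds h10

/-- **(40), Range III′ modulo Proposition 2** (`lemma10'_of_prop2`, sibling `…PrimeSumsProofs`).
[cite: BondarenkoHeap2026, eq. (40) and Lemma 10, TeX l.1108–1123, l.1295–1306] -/
theorem rangeIII'_bound_of_prop2 (h2 : prop2) : rangeIII'_bound :=
  rangeIII'_bound_of_lemma10' (lemma10'_of_prop2 h2)

/-! ### Assembly: Proposition 6 and Theorem 4 modulo {`offDiag_reduction'`, `prop2`} -/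

/-- **Proposition 6 modulo the two boundary facts `offDiag_reduction'` (§6.2 over the primed
interface) and `prop2` (the zero-density input of Lemma 10)**: the three primed range bounds are
now theorems (I′, II′ outright; III′ modulo `prop2`), and `prop6_of_reduction'_of_ranges'`
(sibling `…Section6Weights`) assembles them. [cite: BondarenkoHeap2026, Prop. 6 and §6, TeX
l.745–770, l.1295–1309] -/
theorem prop6_of_reduction'_of_prop2 (hred : offDiag_reduction') (h2 : prop2) : prop6 :=
  prop6_of_reduction'_of_ranges' hred rangeI'_bound_holds rangeII'_bound_holds
    (rangeIII'_bound_of_prop2 h2)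

/-- **Theorem 4 modulo {`offDiag_reduction'`, `prop2`}** (`theorem4_of_prop6`, sibling
`…Prop3Proofs`: Propositions 3, 5 are theorems). [cite: BondarenkoHeap2026, Thm. 4, §2] -/
theorem theorem4_of_reduction'_of_prop2 (hred : offDiag_reduction') (h2 : prop2) : theorem4 :=
  theorem4_of_prop6 (prop6_of_reduction'_of_prop2 hred h2)

end Literature.NumberTheory.LFunctions.BondarenkoHeap2026

end
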